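import Summits.AtomisticToContinuum.FouriersLaw.Theses.HiddenChargeMazur
import Summits.AtomisticToContinuum.FouriersLaw.Theorems.HiddenChargeMazurStaticKuboStubPoissonValue
import Summits.AtomisticToContinuum.FouriersLaw.Theorems.HiddenChargeMazurStaticKuboStubKuboPairing

/-!
# Line `birth`: the VALUE-CLASS variant of `StaticKubo` is a theorem of the tree (planner note, sorry-free)

Crux workfile (`Cruxes/StaticKubo/Lines/birth_valueClassVariant.lean`, lead
`prover-line-stmt-AtomisticToContinuum-13510-0`, 2026-08-17).

`StaticKubo'` below is the crux `HiddenChargeMazur.StaticKubo` with its growth clause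
`|F| + |∂_{p_i}F| + |∂_{q_i}F| ≤ C e^{θH}` replaced by the VALUE bound `|F| ≤ C e^{θH}` (same
`θ < 1/(2T)`), everything else verbatim.  It follows at once from the two landed stubs of the line
(`Stubs.stub_poissonValue`, `Stubs.stub_kuboPairing`).  This is recommendation (b) of the lead's
promote-stub note: if the planners restate the crux in the value class, it is closed by this proof;
the difference between `StaticKubo` and `StaticKubo'` is exactly the weighted gradient bound for the
Kubo corrector (`Lines/birth_gradientBound_reduction.lean`, `Lines/birth_tightness.lean`).
Downstream, `∂_{p_b}F ∈ L²(Gibbs_T)` at the two baths (all that the Thomson/Dirichlet-form arguments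
consume) follows from the value class by the tap energy identity (`Corrector.memLp_partialP_of_poisson`).
-/

noncomputable section

namespace Summit.AtomisticToContinuum.FouriersLaw.Cruxes.StaticKubo.Birth

/-- **The value-class variant of `StaticKubo`** (the crux with `|F| ≤ C e^{θH}` in place of the
first-order growth clause): for `pinnedChain ω₂ lam β γ` (all `> 0`), under weak-NESS uniqueness, along
any steady-state family, for `T > 0`, `N ≥ 2` and every response limit `D`, there is `F ∈ C²` with
`|F| ≤ C e^{θH}` (`θ < 1/(2T)`), `generator N T T F = -J` pointwise and `D·(N-1)T² = ∫ F·J dGibbs_T`.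
[Kundu–Dhar–Narayan 2009, p. 3; Cuneo–Eckmann–Hairer–Rey-Bellet 2018, Thm 2.13] -/
theorem staticKubo_valueClass :
    ∀ ω₂ lam β γ : ℝ, 0 < ω₂ → 0 < lam → 0 < β → 0 < γ → ∀ P : Literature.MathematicalPhysics.KineticTheory.HeatConduction.OscillatorChain, P = Literature.MathematicalPhysics.KineticTheory.HeatConduction.pinnedChain ω₂ lam β γ → (∀ (N : ℕ) (T_L T_R : ℝ), 0 < T_L → 0 < T_R → ∀ μ ν : MeasureTheory.Measure (Literature.MathematicalPhysics.KineticTheory.HeatConduction.PhaseSpace N), P.IsSteadyState N T_L T_R μ → P.IsSteadyState N T_L T_R ν → μ = ν) → ∀ μ : (N : ℕ) → ℝ → ℝ → MeasureTheory.Measure (Literature.MathematicalPhysics.KineticTheory.HeatConduction.PhaseSpace N), (∀ (N : ℕ) (T_L T_R : ℝ), 0 < T_L → 0 < T_R → P.IsSteadyState N T_L T_R (μ N T_L T_R)) → ∀ T : ℝ, 0 < T → ∀ N : ℕ, 2 ≤ N → ∀ D : ℝ, Filter.Tendsto (fun δ : ℝ => P.totalCurrent (μ N (T + δ / 2) (T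 - δ / 2)) / δ) (nhdsWithin 0 {(0 : ℝ)}ᶜ) (nhds D) → ∃ F : Literature.MathematicalPhysics.KineticTheory.HeatConduction.PhaseSpace N → ℝ, ContDiff ℝ 2 F ∧ (∃ C θ : ℝ, θ < 1 / (2 * T) ∧ ∀ z : Literature.MathematicalPhysics.KineticTheory.HeatConduction.PhaseSpace N, |F z| ≤ C * Real.exp (θ * P.hamiltonian N z)) ∧ (∀ z : Literature.MathematicalPhysics.KineticTheory.HeatConduction.PhaseSpace N, P.generator N T T F z = -(∑ i : Fin N, P.bondCurrent N i z)) ∧ D * (((N : ℝ) - 1) * T ^ 2) = ∫ z, F z * (∑ i : Fin N, P.bondCurrent N i z) ∂(MeasureTheory.volume.tilted fun x => -P.hamiltonian N x / T) := by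
  intro ω₂ lam β γ hω hl hβ hγ P hP hU μ hμ T hT N hN D hD
  obtain ⟨F, hF2, hFv, hFL⟩ := Stubs.stub_poissonValue ω₂ lam β γ hω hl hβ hγ P hP T hT N hN
  exact ⟨F, hF2, hFv, hFL, Stubs.stub_kuboPairing ω₂ lam β γ hω hl hβ hγ P hP hU μ hμ T hT N hN D hD F hF2 hFv hFL⟩

end Summit.AtomisticToContinuum.FouriersLaw.Cruxes.StaticKubo.Birth

end
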